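import Literature.Probability.RandomPlanarGeometry.HexSAWBridgeLengthNull
import Literature.Probability.RandomPlanarGeometry.HexSAWHammersleyWelshExplicit
import Mathlib.Analysis.Complex.ExponentialBounds
import Mathlib.Analysis.SpecificLimits.Basic
import Literature.Probability.Process.EricksonRenewalBounds
import HarnessLib

/-!
# Null recurrence of the honeycomb bridge renewal by length: the `μ`-normalised form and a closed Cesàro rate

Topic `Literature/Probability/RandomPlanarGeometry` (corollaries of `HexSAWBridgeLengthNull.lean`, Duminil-Copin–Smirnov STRIP frame:
bridges of the strips `S_T`, crossing parallel to an edge class; lengths = numbers of vertices).  Sources as there: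
N. Madras, G. Slade, *The Self-Avoiding Walk* (1993), §4.2 (p. 92: "`lim_N b_N/μ^N` exists … it is believed that
`lim_N b_N/μ^N = 0`"); H. Duminil-Copin, S. Smirnov, Ann. of Math. 175 (2012), Theorem 1 (`μ_ℍ = √(2+√2) = x_c⁻¹`, tree
`hexConnectiveConstant_eq_inv`); the width decay `B_T(x_c) ≤ 5 (ln T)^{-1/3}` of the tree (`hexBridgeLogDecay`, after
Glazman–Manolescu / Krachun–Panagiotis).

* `tendsto_hvBridgeLen_succ_div_pow` — **the `n`-STEP bridges of the strips are `o(μ_ℍ^n)`**: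
  `#{n-step DCS bridges}/μ_ℍ^n → 0`, the form directly comparable with the tree's `ℤ^d` theorem
  `Zd.tendsto_bridgeCount_div_pow_zero` and with the brick-wall frame's `HexBW.exists_tendsto_bridgeCount_div_pow` (whose limit is
  not decided in the tree); `tendsto_hvBridgeLen_succ_div_hexSawCount` — strip bridges are a vanishing fraction of all
  `n`-step self-avoiding walks (`c_n ≥ μ_ℍ^n`);
* (private) `sum_log_rpow_le` — `Σ_{T=2}^{M} (ln T)^{-1/3} ≤ (12/5) M (ln M)^{-1/3}` (`M ≥ 2`; split at `√M`);
* `succ_le_hvMass_mul_sum_hvR`, `hvMass_mul_sum_hvR_le` — Erickson's sandwich `M+1 ≤ U_M·Σ_{j≤M} r_j ≤ 2M+1`;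
  **`tendsto_hvMass_atTop`**, `not_summable_hvU`, `not_summable_hvBridgeLen_mul_pow` — `Σ_m u_m = Σ_n b_n x_c^n = +∞`: the
  renewal is recurrent AND null (the length grading of Duminil-Copin–Smirnov's `Σ_T B_T(x_c) = +∞`);
* `hvMass_le_mul_log_rpow` — **closed Cesàro rate** `Σ_{m ≤ M} b_{2m}(ℍ) x_c^{2m} ≤ 14 M (ln M)^{-1/3}` (`M ≥ 2`), i.e. the Cesàro
  averages of the critical bridge weights by length are `O((ln M)^{-1/3})` with an explicit constant (the lane's bookkeeping of the
  printed width decay; no rate for `b_N μ^{-N}` is printed for any lattice).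
-/

noncomputable section

open Filter Topology Finset Literature.Probability.LatticeModels Literature.Probability.Process

namespace Literature.Probability.RandomPlanarGeometry.SAW

open HV

/-! ### The `μ`-normalised form -/

/-- **The `n`-step bridges of Duminil-Copin–Smirnov's strips are `o(μ_ℍ^n)`**: `b^{(n)}(ℍ)/μ_ℍ^n → 0`, where
`b^{(n)} = hvBridgeLen (n+1)` counts the strip bridges with `n` steps (`n+1` vertices) and `μ_ℍ = √(2+√2) = x_c⁻¹`
(DCS strip frame; the brick-wall-frame limit of `HexSAWBrickWallBridgeLimit.lean` is not decided here).
[cite: MadrasSlade1993, Theorem 4.2.2 (pp. 91–92; part (b) p. 92) and its consequence for bridges (p. 92); DuminilCopinSmirnov2012, Theorem 1] -/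
theorem tendsto_hvBridgeLen_succ_div_pow :
    Tendsto (fun n : ℕ => (hvBridgeLen (n + 1) : ℝ) / hexConnectiveConstant ^ n) atTop (𝓝 0) := by
  have hx := hexCriticalFugacity_pos_lt_one.1
  have h := (hexBridgeLengthNull.comp (tendsto_add_atTop_nat 1)).div_const hexCriticalFugacity
  rw [zero_div] at h
  refine h.congr fun n => ?_
  simp only [Function.comp_apply]
  rw [hexConnectiveConstant_eq_inv, inv_pow, div_inv_eq_mul, pow_succ, ← mul_assoc, mul_div_assoc, div_self hx.ne',
    mul_one]

/-- **Strip bridges are a vanishing fraction of the self-avoiding walks**: `b^{(n)}(ℍ)/c_n(ℍ) → 0` (`c_n ≥ μ_ℍ^n`, tree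
`hexConnectiveConstant_pow_le`). [cite: MadrasSlade1993, §4.2, p. 92 and eq. (1.2.17); DuminilCopinSmirnov2012, Theorem 1] -/
theorem tendsto_hvBridgeLen_succ_div_hexSawCount :
    Tendsto (fun n : ℕ => (hvBridgeLen (n + 1) : ℝ) / hexSawCount n) atTop (𝓝 0) := by
  have hμ : 0 < hexConnectiveConstant := by
    rw [hexConnectiveConstant_eq_inv]; exact inv_pos.2 hexCriticalFugacity_pos_lt_one.1
  refine squeeze_zero (fun n => by positivity) (fun n => ?_) tendsto_hvBridgeLen_succ_div_pow
  exact div_le_div_of_nonneg_left (Nat.cast_nonneg _) (pow_pos hμ n) (hexConnectiveConstant_pow_le n)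

/-! ### A closed form for the Cesàro rate -/

/-- `(ln 2)^{-1/3} ≤ 1.14`. [folklore] -/
private theorem log_two_rpow_le : (Real.log 2) ^ (-(1 : ℝ) / 3) ≤ 1.14 := by
  have hl : 0 < Real.log 2 := Real.log_pos (by norm_num)
  have hl2 : 0.6931471803 < Real.log 2 := Real.log_two_gt_d9
  -- `(ln 2)^{-1/3} = ((ln 2)⁻¹)^{1/3}` and `(ln 2)⁻¹ ≤ 1.14³`
  have h3 : (Real.log 2)⁻¹ ≤ (1.14 : ℝ) ^ 3 := by
    rw [inv_le_comm₀ hl (by norm_num)]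
    exact le_trans (by norm_num) hl2.le
  have hcalc : (Real.log 2) ^ (-(1 : ℝ) / 3) = ((Real.log 2)⁻¹) ^ ((3 : ℕ) : ℝ)⁻¹ := by
    rw [Real.inv_rpow hl.le, show (-(1 : ℝ) / 3) = -((3 : ℕ) : ℝ)⁻¹ by norm_num, Real.rpow_neg hl.le]
  rw [hcalc]
  calc ((Real.log 2)⁻¹) ^ ((3 : ℕ) : ℝ)⁻¹ ≤ ((1.14 : ℝ) ^ 3) ^ ((3 : ℕ) : ℝ)⁻¹ :=
        Real.rpow_le_rpow (inv_nonneg.2 hl.le) h3 (by positivity)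
    _ = 1.14 := Real.pow_rpow_inv_natCast (by norm_num) (by norm_num)

/-- `2^{1/3} ≤ 1.26`. [folklore] -/
private theorem two_rpow_third_le : (2 : ℝ) ^ ((1 : ℝ) / 3) ≤ 1.26 := by
  have h3 : (2 : ℝ) ≤ (1.26 : ℝ) ^ 3 := by norm_num
  calc (2 : ℝ) ^ ((1 : ℝ) / 3) = (2 : ℝ) ^ ((3 : ℕ) : ℝ)⁻¹ := by norm_num
    _ ≤ ((1.26 : ℝ) ^ 3) ^ ((3 : ℕ) : ℝ)⁻¹ := Real.rpow_le_rpow (by norm_num) h3 (by positivity)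
    _ = 1.26 := Real.pow_rpow_inv_natCast (by norm_num) (by norm_num)

/-- For `2 ≤ T`: `(ln T)^{-1/3} ≤ 1.14`. [folklore] -/
private theorem log_rpow_le_of_two_le {T : ℕ} (hT : 2 ≤ T) : (Real.log T) ^ (-(1 : ℝ) / 3) ≤ 1.14 := by
  have hl : 0 < Real.log 2 := Real.log_pos (by norm_num)
  have hT' : (2 : ℝ) ≤ T := by exact_mod_cast hT
  refine le_trans ?_ log_two_rpow_le
  exact Real.rpow_le_rpow_of_nonpos hl (Real.log_le_log (by norm_num) hT') (by norm_num)

/-- For `T² > M ≥ 2`: `(ln T)^{-1/3} ≤ 1.26 (ln M)^{-1/3}` (`ln T ≥ ½ ln M`). [folklore] -/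
private theorem log_rpow_le_of_sq_gt {T M : ℕ} (hM : 2 ≤ M) (hTM : M < T * T) :
    (Real.log T) ^ (-(1 : ℝ) / 3) ≤ 1.26 * (Real.log M) ^ (-(1 : ℝ) / 3) := by
  have hM' : (2 : ℝ) ≤ M := by exact_mod_cast hM
  have hT1 : 1 ≤ T := by nlinarith
  have hlM : 0 < Real.log M := Real.log_pos (by linarith)
  have hTM' : (M : ℝ) ≤ (T : ℝ) ^ 2 := by exact_mod_cast (by nlinarith : M ≤ T ^ 2)
  -- `½ ln M ≤ ln T`
  have hhalf : 2⁻¹ * Real.log M ≤ Real.log T := by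
    have h := Real.log_le_log (by positivity) hTM'
    rw [Real.log_pow] at h
    push_cast at h
    linarith
  have hpos : 0 < 2⁻¹ * Real.log M := by positivity
  calc (Real.log T) ^ (-(1 : ℝ) / 3) ≤ (2⁻¹ * Real.log M) ^ (-(1 : ℝ) / 3) :=
        Real.rpow_le_rpow_of_nonpos hpos hhalf (by norm_num)
    _ = (2⁻¹ : ℝ) ^ (-(1 : ℝ) / 3) * (Real.log M) ^ (-(1 : ℝ) / 3) := Real.mul_rpow (by norm_num) hlM.le
    _ = (2 : ℝ) ^ ((1 : ℝ) / 3) * (Real.log M) ^ (-(1 : ℝ) / 3) := by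
        rw [Real.inv_rpow (by norm_num : (0 : ℝ) ≤ 2), ← Real.rpow_neg (by norm_num : (0 : ℝ) ≤ 2)]
        norm_num
    _ ≤ 1.26 * (Real.log M) ^ (-(1 : ℝ) / 3) :=
        mul_le_mul_of_nonneg_right two_rpow_third_le (Real.rpow_nonneg hlM.le _)

/-- `⌊√M⌋ ≤ M (ln M)^{-1/3}` for `M ≥ 2` (`ln M ≤ M ≤ (M/⌊√M⌋)³`). [folklore] -/
private theorem sqrt_le_mul_log_rpow {M : ℕ} (hM : 2 ≤ M) :
    (Nat.sqrt M : ℝ) ≤ M * (Real.log M) ^ (-(1 : ℝ) / 3) := by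
  set s := Nat.sqrt M with hs
  have hM' : (2 : ℝ) ≤ M := by exact_mod_cast hM
  have hlM : 0 < Real.log M := Real.log_pos (by linarith)
  have hs1 : 1 ≤ s := Nat.le_sqrt.2 (by omega)
  have hsM : s * s ≤ M := Nat.sqrt_le M
  have hs0 : (0 : ℝ) < s := by exact_mod_cast hs1
  -- `ln M ≤ (M/s)^3`
  have hcube : Real.log M ≤ ((M : ℝ) / s) ^ 3 := by
    have h1 : Real.log M ≤ M := by linarith [Real.log_le_sub_one_of_pos (by linarith : (0 : ℝ) < M)]
    have h2 : (M : ℝ) ≤ ((M : ℝ) / s) ^ 3 := by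
      rw [div_pow, le_div_iff₀ (by positivity)]
      have : (M : ℝ) * (s : ℝ) ^ 3 ≤ (M : ℝ) ^ 3 := by
        have hnat : M * s ^ 3 ≤ M ^ 3 := by
          have hsM' : s ≤ M := le_trans (Nat.le_mul_self s) hsM
          calc M * s ^ 3 = M * (s * s) * s := by ring
            _ ≤ M * M * M := Nat.mul_le_mul (Nat.mul_le_mul_left _ hsM) hsM'
            _ = M ^ 3 := by ring
        exact_mod_cast hnat
      linarith
    exact h1.trans h2
  -- cube roots: `(ln M)^{1/3} ≤ M/s`, then invert
  have hroot : (Real.log M) ^ ((3 : ℕ) : ℝ)⁻¹ ≤ (M : ℝ) / s := by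
    calc (Real.log M) ^ ((3 : ℕ) : ℝ)⁻¹ ≤ (((M : ℝ) / s) ^ 3) ^ ((3 : ℕ) : ℝ)⁻¹ :=
          Real.rpow_le_rpow hlM.le hcube (by positivity)
      _ = (M : ℝ) / s := Real.pow_rpow_inv_natCast (by positivity) (by norm_num)
  have hrpos : 0 < (Real.log M) ^ ((3 : ℕ) : ℝ)⁻¹ := Real.rpow_pos_of_pos hlM _
  have hneg : (Real.log M) ^ (-(1 : ℝ) / 3) = ((Real.log M) ^ ((3 : ℕ) : ℝ)⁻¹)⁻¹ := by
    rw [show (-(1 : ℝ) / 3) = -((3 : ℕ) : ℝ)⁻¹ by norm_num, Real.rpow_neg hlM.le]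
  rw [hneg, ← div_eq_mul_inv, le_div_iff₀ hrpos]
  calc (s : ℝ) * (Real.log M) ^ ((3 : ℕ) : ℝ)⁻¹ ≤ s * ((M : ℝ) / s) := mul_le_mul_of_nonneg_left hroot hs0.le
    _ = M := mul_div_cancel₀ _ hs0.ne'

/-- `1 ≤ M (ln M)^{-1/3}` for `M ≥ 2`. [folklore] -/
private theorem one_le_mul_log_rpow {M : ℕ} (hM : 2 ≤ M) : (1 : ℝ) ≤ M * (Real.log M) ^ (-(1 : ℝ) / 3) := by
  have hs1 : 1 ≤ Nat.sqrt M := Nat.le_sqrt.2 (by omega)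
  exact le_trans (by exact_mod_cast hs1) (sqrt_le_mul_log_rpow hM)

/-- **`Σ_{T=2}^{M} (ln T)^{-1/3} ≤ (12/5)·M·(ln M)^{-1/3}`** (`M ≥ 2`): the terms with `T² ≤ M` are at most `⌊√M⌋` in number and each
`≤ (ln 2)^{-1/3} ≤ 1.14`, the others satisfy `ln T ≥ ½ ln M`. [folklore] -/
private theorem sum_log_rpow_le (M : ℕ) (hM : 2 ≤ M) :
    ∑ T ∈ Icc 2 M, (Real.log T) ^ (-(1 : ℝ) / 3) ≤ 12 / 5 * M * (Real.log M) ^ (-(1 : ℝ) / 3) := by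
  set r := (Real.log M) ^ (-(1 : ℝ) / 3) with hr
  have hM' : (2 : ℝ) ≤ M := by exact_mod_cast hM
  have hlM : 0 < Real.log M := Real.log_pos (by linarith)
  have hr0 : 0 ≤ r := Real.rpow_nonneg hlM.le _
  rw [← sum_filter_add_sum_filter_not (Icc 2 M) (fun T => T * T ≤ M)]
  -- small `T`: at most `√M` terms, each `≤ 1.14`
  have hsmall : ∑ T ∈ (Icc 2 M).filter (fun T => T * T ≤ M), (Real.log T) ^ (-(1 : ℝ) / 3) ≤ 1.14 * (M * r) := by
    have hcard : #((Icc 2 M).filter fun T => T * T ≤ M) ≤ Nat.sqrt M := by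
      calc #((Icc 2 M).filter fun T => T * T ≤ M) ≤ #(Icc 1 (Nat.sqrt M)) :=
            card_le_card fun T hT => by
              rw [mem_filter, mem_Icc] at hT
              rw [mem_Icc]
              exact ⟨by omega, Nat.le_sqrt.2 hT.2⟩
        _ = Nat.sqrt M := by simp
    calc ∑ T ∈ (Icc 2 M).filter (fun T => T * T ≤ M), (Real.log T) ^ (-(1 : ℝ) / 3)
        ≤ ∑ T ∈ (Icc 2 M).filter (fun T => T * T ≤ M), (1.14 : ℝ) :=
          sum_le_sum fun T hT => log_rpow_le_of_two_le (mem_Icc.1 (mem_filter.1 hT).1).1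
      _ = #((Icc 2 M).filter fun T => T * T ≤ M) * 1.14 := by rw [sum_const, nsmul_eq_mul]
      _ ≤ (Nat.sqrt M : ℝ) * 1.14 := mul_le_mul_of_nonneg_right (by exact_mod_cast hcard) (by norm_num)
      _ ≤ (M * r) * 1.14 := mul_le_mul_of_nonneg_right (sqrt_le_mul_log_rpow hM) (by norm_num)
      _ = 1.14 * (M * r) := mul_comm _ _
  -- large `T`: at most `M` terms, each `≤ 1.26 r`
  have hlarge : ∑ T ∈ (Icc 2 M).filter (fun T => ¬ T * T ≤ M), (Real.log T) ^ (-(1 : ℝ) / 3) ≤ 1.26 * (M * r) := by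
    calc ∑ T ∈ (Icc 2 M).filter (fun T => ¬ T * T ≤ M), (Real.log T) ^ (-(1 : ℝ) / 3)
        ≤ ∑ T ∈ (Icc 2 M).filter (fun T => ¬ T * T ≤ M), 1.26 * r :=
          sum_le_sum fun T hT => log_rpow_le_of_sq_gt hM (not_le.1 (mem_filter.1 hT).2)
      _ = #((Icc 2 M).filter fun T => ¬ T * T ≤ M) * (1.26 * r) := by rw [sum_const, nsmul_eq_mul]
      _ ≤ (M : ℝ) * (1.26 * r) := by
          refine mul_le_mul_of_nonneg_right ?_ (by positivity)
          have hc : #((Icc 2 M).filter fun T => ¬ T * T ≤ M) ≤ M :=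
            (card_le_card (filter_subset _ _)).trans (by rw [Nat.card_Icc]; omega)
          exact_mod_cast hc
      _ = 1.26 * (M * r) := by ring
  calc _ ≤ 1.14 * (M * r) + 1.26 * (M * r) := add_le_add hsmall hlarge
    _ = 12 / 5 * M * r := by ring

/-- **Closed Cesàro rate for the critical bridge weights by length (DCS strip frame)**:
`Σ_{m ≤ M} b_{2m}(ℍ) x_c^{2m} ≤ 14 · M · (ln M)^{-1/3}` for `M ≥ 2` — the Cesàro averages of `u_m = b_{2m} x_c^{2m}` are
`O((ln M)^{-1/3})` with an explicit constant (from `hexBridgeMassLogBound` and `sum_log_rpow_le`).  Lane bookkeeping of the printed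
width decay; not in print. [cite: MadrasSlade1993, §4.2, p. 92; KrachunPanagiotis2026, Lemma 2.3] -/
theorem hvMass_le_mul_log_rpow (M : ℕ) (hM : 2 ≤ M) : hvMass M ≤ 14 * M * (Real.log M) ^ (-(1 : ℝ) / 3) := by
  have h1 := hexBridgeMassLogBound M (by omega)
  have h2 := sum_log_rpow_le M hM
  have h3 := one_le_mul_log_rpow hM
  nlinarith

/-- The averaged form: `(M+1)⁻¹ Σ_{m ≤ M} u_m ≤ 14 (ln M)^{-1/3}` (`M ≥ 2`). [cite: MadrasSlade1993, §4.2, p. 92] -/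
theorem hvMass_div_le_log_rpow (M : ℕ) (hM : 2 ≤ M) :
    hvMass M / (M + 1) ≤ 14 * (Real.log M) ^ (-(1 : ℝ) / 3) := by
  have hM' : (2 : ℝ) ≤ M := by exact_mod_cast hM
  have hlM : 0 < Real.log M := Real.log_pos (by linarith)
  have hr0 : 0 ≤ (Real.log M) ^ (-(1 : ℝ) / 3) := Real.rpow_nonneg hlM.le _
  rw [div_le_iff₀ (by positivity)]
  have h := hvMass_le_mul_log_rpow M hM
  nlinarith


/-! ### Null recurrence proper: `Σ_m u_m = ∞` while `u_m → 0` -/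

/-- `r_0 = 1`. [cite: MadrasSlade1993, Appendix B, (B.5)] -/
theorem hvR_zero : hvR 0 = 1 := by simp [hvR, hvF_zero]

/-- `r_j ≥ 0` (tail of a probability law). [cite: MadrasSlade1993, Appendix B, (B.5)] -/
theorem hvR_nonneg (j : ℕ) : 0 ≤ hvR j :=
  Renewal.tailSum_nonneg (f := hvF) (fun _ => rfl) hvF_nonneg hasSum_hvF j

/-- `r_j → 0` (tail of the convergent series `Σ f = 1`). [cite: MadrasSlade1993, Appendix B] -/
theorem tendsto_hvR_zero : Tendsto hvR atTop (𝓝 0) :=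
  Renewal.tendsto_tailSum (f := hvF) (fun _ => rfl) hasSum_hvF

/-- **Erickson's sandwich, lower half, for the strip-bridge renewal by half-length**:
`M + 1 ≤ U_M · Σ_{j ≤ M} r_j`. [cite: Erickson1973, Lemma 1] -/
theorem succ_le_hvMass_mul_sum_hvR (M : ℕ) : (M : ℝ) + 1 ≤ hvMass M * ∑ j ∈ range (M + 1), hvR j := by
  rw [hvMass]
  exact Renewal.erickson_lower_of_hasSum (r := hvR) (fun _ => rfl) hvU_zero hvF_zero hvU_renewal hvU_nonneg
    hvF_nonneg hasSum_hvF M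

/-- **Erickson's sandwich, upper half**: `U_M · Σ_{j ≤ M} r_j ≤ 2M + 1`. [cite: Erickson1973, Lemma 1] -/
theorem hvMass_mul_sum_hvR_le (M : ℕ) : hvMass M * ∑ j ∈ range (M + 1), hvR j ≤ 2 * (M : ℝ) + 1 := by
  rw [hvMass]
  exact Renewal.erickson_upper_of_hasSum (r := hvR) (fun _ => rfl) hvU_zero hvF_zero hvU_renewal hvU_nonneg
    hvF_nonneg hasSum_hvF M

/-- **`Σ_m u_m = ∞`**: the partial sums `U_M = Σ_{m ≤ M} b_{2m}(ℍ) x_c^{2m}` tend to infinity — the renewal is RECURRENT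
(`Σ f = 1`) as well as null (`u_m → 0`): by Erickson, `U_M ≥ (M+1)/Σ_{j ≤ M} r_j` and the Cesàro means of `r_j → 0` vanish.
(The length grading of Duminil-Copin–Smirnov's `Σ_T B_T(x_c) = +∞`.) [cite: Erickson1973, Lemma 1; DuminilCopinSmirnov2012, §3
("Z(x_c) ≥ Σ_T B_T^{x_c} = +∞"); Feller1968, XIII.3] -/
theorem tendsto_hvMass_atTop : Tendsto hvMass atTop atTop := by
  -- Cesàro means of the tails
  set a : ℕ → ℝ := fun M => ((M + 1 : ℕ) : ℝ)⁻¹ * ∑ j ∈ range (M + 1), hvR j with ha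
  have hces : Tendsto a atTop (𝓝 0) := by
    have h := (tendsto_hvR_zero.cesaro).comp (tendsto_add_atTop_nat 1)
    exact h
  have hpos : ∀ M, 0 < a M := fun M => by
    have h1 : hvR 0 ≤ ∑ j ∈ range (M + 1), hvR j :=
      single_le_sum (f := hvR) (fun j _ => hvR_nonneg j) (by simp)
    have h2 : 0 < ∑ j ∈ range (M + 1), hvR j := by linarith [hvR_zero]
    simp only [ha]
    positivity
  have hwithin : Tendsto a atTop (𝓝[>] 0) :=
    tendsto_nhdsWithin_iff.2 ⟨hces, Eventually.of_forall fun M => hpos M⟩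
  have hinv : Tendsto (fun M => (a M)⁻¹) atTop atTop := hwithin.inv_tendsto_nhdsGT_zero
  refine tendsto_atTop_mono (fun M => ?_) hinv
  -- `a_M⁻¹ ≤ U_M` from `M + 1 ≤ U_M · Σ r`
  have hE := succ_le_hvMass_mul_sum_hvR M
  have hM1 : (0 : ℝ) < ((M + 1 : ℕ) : ℝ) := by positivity
  rw [inv_le_iff_one_le_mul₀ (hpos M)]
  have : hvMass M * a M = (((M + 1 : ℕ) : ℝ))⁻¹ * (hvMass M * ∑ j ∈ range (M + 1), hvR j) := by
    simp only [ha]; ring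
  rw [this, le_inv_mul_iff₀ hM1, mul_one]
  push_cast
  linarith

/-- **`Σ_m u_m = ∞`** as non-summability of `u_m = b_{2m}(ℍ) x_c^{2m}`. [cite: Feller1968, XIII.3; DuminilCopinSmirnov2012, §3] -/
theorem not_summable_hvU : ¬ Summable hvU := fun hs => by
  have hb : Tendsto hvMass atTop (𝓝 (∑' m, hvU m)) := by
    have h := hs.tendsto_sum_tsum_nat.comp (tendsto_add_atTop_nat 1)
    exact h.congr fun M => rfl
  exact not_tendsto_atTop_of_tendsto_nhds hb tendsto_hvMass_atTop

/-- **The strip-bridge generating function BY LENGTH diverges at `x_c`**: `Σ_n b_n(ℍ) x_c^n = +∞` (Duminil-Copin–Smirnov's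
`Σ_T B_T(x_c) = +∞`, regraded by length). [cite: DuminilCopinSmirnov2012, §3 ("Z(x_c) ≥ Σ_T B_T^{x_c} = +∞"); MadrasSlade1993,
Corollary 3.1.8 shape] -/
theorem not_summable_hvBridgeLen_mul_pow :
    ¬ Summable (fun n : ℕ => (hvBridgeLen n : ℝ) * hexCriticalFugacity ^ n) := by
  intro hs
  have hinj : Function.Injective fun m : ℕ => 2 * m := fun a b h => by simpa using h
  have h2 : Summable (fun m : ℕ => (hvBridgeLen (2 * m) : ℝ) * hexCriticalFugacity ^ (2 * m)) :=
    hs.comp_injective hinj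
  apply not_summable_hvU
  rw [← summable_nat_add_iff 1]
  refine ((summable_nat_add_iff 1).2 h2).congr fun m => ?_
  rw [hvU_of_ne (Nat.succ_ne_zero m)]

end Literature.Probability.RandomPlanarGeometry.SAW

end
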